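import Summits.RiemannHypothesis.RiemannHypothesis.Theorems.SignConeConeMagnificationCombTypeNodeMain
import Literature.NumberTheory.Sieve.SelbergSymmetryFormula

/-!
# Crux `SignCone.ConeMagnification` (stmt-RiemannHypothesis-16303), line `Sketch` r9, stub `stub_combType` — sharp node evaluation VIII:
# the per-node errors in the form `e₀ + e₁/n` (main range)

Backstop, part 8.  `CombType.node_sharp_main` simplifies the raw bound of `CombType.node_sharp_main_raw` to `e₀ + e₁/n` with
`e₀ = h·L²·((32N₁ + 28N₀)(1 + 7√(κL)) + 48N₀)` and `e₁ = hκ·L³(3072N₁ + 264N₀) + h(1 + log M)L(192N₁ + 12N₀) + (4C₂ + 10N₂)L²/κ`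
(`κ = hM`, `C₂ = (N₀+2N₁+N₂)(96+192L)L²`), using `K₁ ≤ LM/n`, `M ≤ 4LnK₁`, `1/(8hnℓ') ≤ K₀'`, `κ/(4L) ≤ V`, `log(M₀+1) ≤ 7√(κL)`.
The corner nodes are in `…CombTypeNodeCorner`.
-/

noncomputable section

-- `Summit.RiemannHypothesis.RiemannHypothesis.…` repeats a namespace component by design (D-0017 layout).
set_option linter.dupNamespace false

open scoped BigOperators
open MeasureTheory Set

namespace Summit.RiemannHypothesis.RiemannHypothesis.Theorems.SignConeConeMagnification

open Literature.NumberTheory.LFunctions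

namespace CombType

/-- `√ℓ/√ℓ' ≤ L` for `1 ≤ ℓ, ℓ' ≤ L`. [folklore] -/
theorem sqrt_ratio_le {ℓ ℓ' L : ℕ} (hℓ : 1 ≤ ℓ) (hℓL : ℓ ≤ L) (hℓ' : 1 ≤ ℓ') :
    Real.sqrt ℓ / Real.sqrt ℓ' ≤ L := by
  have hℓR : (1 : ℝ) ≤ ℓ := by exact_mod_cast hℓ
  have hℓLR : (ℓ : ℝ) ≤ L := by exact_mod_cast hℓL
  have hℓ'R : (1 : ℝ) ≤ ℓ' := by exact_mod_cast hℓ'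
  have hLR : (1 : ℝ) ≤ L := le_trans hℓR hℓLR
  have h1' : Real.sqrt (ℓ : ℝ) ≤ L := by
    rw [Real.sqrt_le_left (by linarith)]
    calc (ℓ : ℝ) ≤ L := hℓLR
      _ = L * 1 := (mul_one _).symm
      _ ≤ L * L := mul_le_mul_of_nonneg_left hLR (by linarith)
      _ = L ^ 2 := (sq _).symm
  have h2' : 1 ≤ Real.sqrt (ℓ' : ℝ) := by rw [Real.le_sqrt' one_pos, one_pow]; exact hℓ'R
  calc Real.sqrt ℓ / Real.sqrt ℓ' ≤ Real.sqrt ℓ / 1 := div_le_div_of_nonneg_left (Real.sqrt_nonneg _) one_pos h2'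
    _ ≤ L := by rw [div_one]; exact h1'

/-- `log(⌈8κL⌉ + 1) ≤ 7√(κL)` for `κ, L ≥ 1`. [folklore] -/
theorem log_ceil_le {κ Lr : ℝ} (hκ : 1 ≤ κ) (hL : 1 ≤ Lr) :
    Real.log ((⌈8 * κ * Lr⌉₊ : ℕ) + 1) ≤ 7 * Real.sqrt (κ * Lr) := by
  have hκL : 1 ≤ κ * Lr := by nlinarith
  have hc : ((⌈8 * κ * Lr⌉₊ : ℕ) : ℝ) < 8 * κ * Lr + 1 := Nat.ceil_lt_add_one (by positivity)
  have hpos : (0 : ℝ) < (⌈8 * κ * Lr⌉₊ : ℕ) + 1 := by positivity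
  have h1 : Real.log ((⌈8 * κ * Lr⌉₊ : ℕ) + 1) ≤ Real.log (10 * (κ * Lr)) :=
    Real.log_le_log hpos (by nlinarith)
  have h2 := Literature.NumberTheory.Sieve.SelbergSymmetry.log_le_two_mul_sqrt (show (0 : ℝ) < 10 * (κ * Lr) by positivity)
  have h3 : Real.sqrt (10 * (κ * Lr)) = Real.sqrt 10 * Real.sqrt (κ * Lr) := Real.sqrt_mul (by norm_num) _
  have h4 : Real.sqrt 10 ≤ 7 / 2 := by
    rw [Real.sqrt_le_left (by norm_num)]; norm_num
  have h5 : 0 ≤ Real.sqrt (κ * Lr) := Real.sqrt_nonneg _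
  calc Real.log ((⌈8 * κ * Lr⌉₊ : ℕ) + 1) ≤ 2 * Real.sqrt (10 * (κ * Lr)) := h1.trans h2
    _ = 2 * Real.sqrt 10 * Real.sqrt (κ * Lr) := by rw [h3]; ring
    _ ≤ 2 * (7 / 2) * Real.sqrt (κ * Lr) := by nlinarith
    _ = 7 * Real.sqrt (κ * Lr) := by ring

set_option maxHeartbeats 1600000 in
/-- **The sharp node weight of a main-range node**, errors in the form `e₀ + e₁/n`.  See the module docstring. [folklore] -/
theorem node_sharp_main {B B' B'' : ℝ → ℝ} {N₀ N₁ N₂ h : ℝ} {L ℓ ℓ' M n : ℕ}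
    (hB : ∀ x, HasDerivAt B (B' x) x) (hB' : ∀ x, HasDerivAt B' (B'' x) x)
    (h0 : ∀ x, |B x| ≤ N₀) (h1 : ∀ x, |B' x| ≤ N₁) (h2 : ∀ x, |B'' x| ≤ N₂)
    (hBs : ∀ x, 2 < |x| → B x = 0) (hB0 : ∀ x, 0 ≤ B x)
    (hL : 1 ≤ L) (hℓ : 1 ≤ ℓ) (hℓL : ℓ ≤ L) (hℓ' : 1 ≤ ℓ') (hℓ'L : ℓ' ≤ L) (hn : 1 ≤ n)
    (hh : 0 < h) (hhL : h ≤ 1 / (32 * L)) (hhM : 1 ≤ h * M) (hκL : 2 * (L : ℝ) ≤ h * M) (hnY : 8 * h * L ^ 2 * n ≤ 1) :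
    |(∑ k' ∈ Finset.Icc 1 M,
        (∑ k ∈ Finset.Icc 1 M, B ((Real.log ((n : ℝ) * ℓ' * k' / ℓ) - Real.log k) / h) / Real.sqrt k)
          / Real.sqrt k' / Real.sqrt n)
      - B 0 * (Real.sqrt ℓ / Real.sqrt ℓ') *
          (∑ k' ∈ Finset.Icc 1 ⌊1 / (4 * h) / ((n : ℝ) * ℓ')⌋₊,
            (if ℓ ∣ n * ℓ' * k' then 1 / (k' : ℝ) else 0)) / n
      - h * (∫ v, B v * Real.exp (-(h * v) / 2)) * (Real.sqrt ℓ' / Real.sqrt ℓ) *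
          ((min M ⌊(ℓ : ℝ) * M * Real.exp (-(2 * h)) / (ℓ' * n)⌋₊
              - ⌊1 / (4 * h) / ((n : ℝ) * ℓ')⌋₊ : ℕ) : ℝ)
      - ((Real.sqrt ℓ / Real.sqrt ℓ') * ((Nat.gcd (n * ℓ') ℓ : ℝ) / ℓ) *
            (B 0 * Real.log (2 * (Nat.gcd (n * ℓ') ℓ : ℝ))
              + (∫ v in Ioi (1 / 2 : ℝ), ((∑' m : ℤ, B (m / v)) - v * ∫ x, B x) / v) - (∫ x, B x) / 2)
          + (∫ v, B v * Real.exp (-(h * v) / 2)) * (Real.sqrt ℓ' / Real.sqrt ℓ) / (4 * ℓ')) / n|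
      ≤ h * L ^ 2 * ((32 * N₁ + 28 * N₀) * (1 + 7 * Real.sqrt (h * M * L)) + 48 * N₀)
        + (h * (h * M) * L ^ 3 * (3072 * N₁ + 264 * N₀) + h * (1 + Real.log M) * L * (192 * N₁ + 12 * N₀)
            + (4 * ((N₀ + 2 * N₁ + N₂) * (96 + 192 * L) * L ^ 2) + 10 * N₂) * L ^ 2 / (h * M)) / n := by
  have hraw := node_sharp_main_raw (M := M) hB hB' h0 h1 h2 hBs hB0 hL hℓ hℓL hℓ' hℓ'L hn hh hhL hhM hκL hnY
  refine hraw.trans ?_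
  have hN₀ : 0 ≤ N₀ := (abs_nonneg _).trans (h0 0)
  have hN₁ : 0 ≤ N₁ := (abs_nonneg _).trans (h1 0)
  have hN₂ : 0 ≤ N₂ := (abs_nonneg _).trans (h2 0)
  have hLR : (1 : ℝ) ≤ L := by exact_mod_cast hL
  have hnR : (1 : ℝ) ≤ n := by exact_mod_cast hn
  have hn0 : (0 : ℝ) < n := by linarith
  have hℓ'R : (1 : ℝ) ≤ ℓ' := by exact_mod_cast hℓ'
  have hℓ'LR : (ℓ' : ℝ) ≤ L := by exact_mod_cast hℓ'L
  have hℓLR : (ℓ : ℝ) ≤ L := by exact_mod_cast hℓL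
  have hℓR : (1 : ℝ) ≤ ℓ := by exact_mod_cast hℓ
  have h32 : 1 / (32 * (L : ℝ)) ≤ 1 / 32 := one_div_le_one_div_of_le (by norm_num) (by linarith)
  have hh4 : h ≤ 1 / 4 := by linarith
  have hM0 : (0 : ℝ) < M := by
    rcases Nat.eq_zero_or_pos M with hM | hM
    · rw [hM, Nat.cast_zero, mul_zero] at hhM; linarith
    · exact_mod_cast hM
  have hMh : 1 / (M : ℝ) ≤ h := by rw [div_le_iff₀ hM0]; linarith
  have hK₁M' : ((min M ⌊(ℓ : ℝ) * M * Real.exp (-(2 * h)) / (ℓ' * n)⌋₊ : ℕ) : ℝ) ≤ M := by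
    have := node_ranges (M := M) hℓ hℓ' hn hh hh4 hhM
    exact Nat.cast_le.2 this.2.1
  obtain ⟨hP1, hPL, hg1, hgℓ, hga, hPg⟩ := quot_gcd_bounds (L := L) hn hℓ hℓL hℓ'
  obtain ⟨hPK₀, hK₀low, -, -, -⟩ := node_main_deep hL hn hℓ hℓL hℓ' hℓ'L hh hnY
  obtain ⟨hPK₁, hK₁M, hK₁le, -, hM4, hVlow, -⟩ := node_main_teeth (M := M) hL hn hℓ hℓL hℓ' hℓ'L hh hhL hhM hκL hnY
  -- names
  set K₀r : ℝ := ((⌊1 / (4 * h) / ((n : ℝ) * ℓ')⌋₊ : ℕ) : ℝ) with hK₀r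
  set K₁r : ℝ := ((min M ⌊(ℓ : ℝ) * M * Real.exp (-(2 * h)) / (ℓ' * n)⌋₊ : ℕ) : ℝ) with hK₁r
  set gr : ℝ := (Nat.gcd (n * ℓ') ℓ : ℝ) with hgr
  set Pr : ℝ := ((ℓ / Nat.gcd (n * ℓ') ℓ : ℕ) : ℝ) with hPr
  set ρ : ℝ := Real.sqrt ℓ / Real.sqrt ℓ' with hρ
  set ρ' : ℝ := Real.sqrt ℓ' / Real.sqrt ℓ with hρ'
  set β : ℝ := ∫ v, B v * Real.exp (-(h * v) / 2) with hβ
  set κ : ℝ := h * M with hκ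
  set HK : ℝ := ∑ j ∈ Finset.Icc 1 (min M ⌊(ℓ : ℝ) * M * Real.exp (-(2 * h)) / (ℓ' * n)⌋₊), (1 : ℝ) / j with hHK
  set C₂ : ℝ := (N₀ + 2 * N₁ + N₂) * (96 + 192 * L) * L ^ 2 with hC₂
  have hκ1 : 1 ≤ κ := hhM
  have hκ2L : 2 * (L : ℝ) ≤ κ := hκL
  have hκ0 : 0 < κ := by linarith
  have hρL : ρ ≤ L := sqrt_ratio_le hℓ hℓL hℓ'
  have hρ'L : ρ' ≤ L := sqrt_ratio_le hℓ' hℓ'L hℓ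
  have hρ0 : 0 ≤ ρ := by positivity
  have hρ'0 : 0 ≤ ρ' := by positivity
  have hβ0 : 0 ≤ β := toothBeta_nonneg hB0 h
  have hβ8 : β ≤ 8 * N₀ := toothBeta_le hB0 h0 hBs hh.le hh4
  have hB00 : 0 ≤ B 0 := hB0 0
  have hB0N : B 0 ≤ N₀ := (le_abs_self _).trans (h0 0)
  have hg0 : 0 < gr := by rw [hgr]; linarith
  have hP0 : 0 < Pr := by rw [hPr]; linarith
  have hK₁0 : 0 < K₁r := lt_of_lt_of_le hP0 hPK₁
  have hK₀0 : 0 < K₀r := lt_of_lt_of_le hP0 hPK₀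
  have hC₂0 : 0 ≤ C₂ := by positivity
  -- useful products
  have hK₁LM : K₁r ≤ L * M / n := by
    refine hK₁le.trans ?_
    rw [div_le_div_iff₀ (by positivity) hn0]
    have : (ℓ : ℝ) * M * n ≤ L * M * n := by
      have := mul_le_mul_of_nonneg_right hℓLR (by positivity : (0 : ℝ) ≤ M * n); linarith [this]
    calc (ℓ : ℝ) * M * n ≤ L * M * n := this
      _ ≤ L * M * (ℓ' * n) := by
          have h' : (L : ℝ) * M * n * 1 ≤ L * M * n * ℓ' := mul_le_mul_of_nonneg_left hℓ'R (by positivity)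
          linarith
  have hK₁inv : K₁r⁻¹ ≤ 4 * L * n / M := by
    rw [inv_eq_one_div, div_le_div_iff₀ hK₁0 hM0]; linarith
  have hK₀inv : 1 / K₀r ≤ 8 * h * n * L := by
    have h' : 1 / K₀r ≤ 8 * h * n * ℓ' := by
      rw [div_le_iff₀ hK₀0]
      have := mul_le_mul_of_nonneg_left hK₀low (by positivity : (0 : ℝ) ≤ 8 * h * n * ℓ')
      rw [mul_one_div_cancel (by positivity)] at this
      linarith
    have h'' : 8 * h * n * (ℓ' : ℝ) ≤ 8 * h * n * L := mul_le_mul_of_nonneg_left hℓ'LR (by positivity)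
    linarith
  have hVinv : 1 / (K₁r * n * ℓ' * h / gr) ≤ 4 * L / κ := by
    have hV0 : 0 < K₁r * n * ℓ' * h / gr := by positivity
    rw [div_le_div_iff₀ hV0 hκ0]
    have := hVlow
    rw [div_le_iff₀ (by positivity)] at this
    linarith
  -- (A) family block
  have hHK : HK ≤ 1 + Real.log M := by
    refine (LevinsonSums.sum_Icc_one_div_le _).trans ?_
    have h1 : (1 : ℝ) ≤ K₁r := le_trans hP1 hPK₁
    have : Real.log K₁r ≤ Real.log M := Real.log_le_log (by linarith) hK₁M'
    linarith
  have hlogM0 : 0 ≤ 1 + Real.log (M : ℝ) := by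
    have : 0 ≤ Real.log (M : ℝ) := Real.log_nonneg (by
      have : (1 : ℝ) ≤ h * M := hhM
      nlinarith)
    linarith
  have hlogM₀ : Real.log ((⌈8 * (h * M) * L⌉₊ : ℕ) + 1) ≤ 7 * Real.sqrt (h * M * L) := by
    have := log_ceil_le (κ := h * M) (Lr := (L : ℝ)) hκ1 hLR
    simpa only [mul_assoc] using this
  have hsq0 : 0 ≤ Real.sqrt (h * M * L) := Real.sqrt_nonneg _
  have hA1 : (192 * N₁ + 12 * N₀) * h * ρ * (16 * h * ℓ' * K₁r / gr)
      ≤ (192 * N₁ + 12 * N₀) * 16 * L ^ 3 * h * κ / n := by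
    have h1 : 16 * h * ℓ' * K₁r / gr ≤ 16 * h * ℓ' * K₁r := div_le_self (by positivity) (by linarith)
    have h2 : 16 * h * (ℓ' : ℝ) * K₁r ≤ 16 * h * L * (L * M / n) :=
      mul_le_mul (mul_le_mul_of_nonneg_left hℓ'LR (by positivity)) hK₁LM hK₁0.le (by positivity)
    calc (192 * N₁ + 12 * N₀) * h * ρ * (16 * h * ℓ' * K₁r / gr)
        ≤ (192 * N₁ + 12 * N₀) * h * L * (16 * h * L * (L * M / n)) :=
          mul_le_mul (mul_le_mul_of_nonneg_left hρL (by positivity)) (h1.trans h2) (by positivity) (by positivity)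
      _ = (192 * N₁ + 12 * N₀) * 16 * L ^ 3 * h * κ / n := by rw [hκ]; field_simp
  have hA2 : (192 * N₁ + 12 * N₀) * h * ρ * (HK / n) ≤ (192 * N₁ + 12 * N₀) * h * L * (1 + Real.log M) / n := by
    have hHK0 : 0 ≤ HK := Finset.sum_nonneg fun j _ => by positivity
    calc (192 * N₁ + 12 * N₀) * h * ρ * (HK / n) ≤ (192 * N₁ + 12 * N₀) * h * L * ((1 + Real.log M) / n) :=
          mul_le_mul (mul_le_mul_of_nonneg_left hρL (by positivity)) (div_le_div_of_nonneg_right hHK hn0.le)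
            (by positivity) (by positivity)
      _ = _ := by ring
  have hA3 : (16 * N₁ + 14 * N₀) * ρ * (ℓ' * h / gr) * (2 * (1 + Real.log ((⌈8 * (h * M) * L⌉₊ : ℕ) + 1)))
      ≤ h * L ^ 2 * ((32 * N₁ + 28 * N₀) * (1 + 7 * Real.sqrt (h * M * L))) := by
    have h1 : (ℓ' : ℝ) * h / gr ≤ L * h := by
      calc (ℓ' : ℝ) * h / gr ≤ ℓ' * h := div_le_self (by positivity) (by linarith)
        _ ≤ L * h := mul_le_mul_of_nonneg_right hℓ'LR hh.le
    have h2 : 2 * (1 + Real.log ((⌈8 * (h * M) * L⌉₊ : ℕ) + 1)) ≤ 2 * (1 + 7 * Real.sqrt (h * M * L)) := by linarith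
    have h3 : 0 ≤ 2 * (1 + Real.log ((⌈8 * (h * M) * L⌉₊ : ℕ) + 1)) := by
      have : 0 ≤ Real.log ((⌈8 * (h * M) * L⌉₊ : ℕ) + 1 : ℝ) := Real.log_nonneg (by
        have : (0 : ℝ) ≤ (⌈8 * (h * M) * L⌉₊ : ℕ) := Nat.cast_nonneg _
        linarith)
      linarith
    calc (16 * N₁ + 14 * N₀) * ρ * (ℓ' * h / gr) * (2 * (1 + Real.log ((⌈8 * (h * M) * L⌉₊ : ℕ) + 1)))
        ≤ (16 * N₁ + 14 * N₀) * L * (L * h) * (2 * (1 + 7 * Real.sqrt (h * M * L))) :=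
          mul_le_mul (mul_le_mul (mul_le_mul_of_nonneg_left hρL (by positivity)) h1 (by positivity) (by positivity))
            h2 h3 (by positivity)
      _ = _ := by ring
  -- (E) edge block
  have hE1 : h * β * L * (8 * h * L * M / n + 1) ≤ 64 * N₀ * L ^ 2 * h * κ / n + 8 * N₀ * L ^ 2 * h := by
    have h1 : h * β * L ≤ h * (8 * N₀) * L := mul_le_mul_of_nonneg_right (mul_le_mul_of_nonneg_left hβ8 hh.le) (by positivity)
    have h2 : 0 ≤ 8 * h * L * M / n + 1 := by positivity
    calc h * β * L * (8 * h * L * M / n + 1) ≤ h * (8 * N₀) * L * (8 * h * L * M / n + 1) :=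
          mul_le_mul_of_nonneg_right h1 h2
      _ = 64 * N₀ * L ^ 2 * h * κ / n + 8 * N₀ * L * h := by rw [hκ]; field_simp; ring
      _ ≤ 64 * N₀ * L ^ 2 * h * κ / n + 8 * N₀ * L ^ 2 * h := by
          have : 8 * N₀ * (L : ℝ) * h * 1 ≤ 8 * N₀ * L * h * L := mul_le_mul_of_nonneg_left hLR (by positivity)
          have e : 8 * N₀ * (L : ℝ) * h * L = 8 * N₀ * L ^ 2 * h := by ring
          linarith
  have hE2 : C₂ / (h * (n : ℝ) ^ 2) * K₁r⁻¹ ≤ 4 * C₂ * L / κ / n := by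
    calc C₂ / (h * (n : ℝ) ^ 2) * K₁r⁻¹ ≤ C₂ / (h * (n : ℝ) ^ 2) * (4 * L * n / M) :=
          mul_le_mul_of_nonneg_left hK₁inv (by positivity)
      _ = 4 * C₂ * L / κ / n := by rw [hκ]; field_simp
  -- (3) harmonic asymptotics term
  have h3 : B 0 * ρ / n * (2 / K₁r + 2 / K₀r + 8 * n * ℓ' * h / Pr) ≤ 32 * N₀ * L ^ 2 * h := by
    have t1 : 2 / K₁r ≤ 8 * L * n / M := by
      have := hK₁inv; rw [inv_eq_one_div] at this
      calc 2 / K₁r = 2 * (1 / K₁r) := by ring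
        _ ≤ 2 * (4 * L * n / M) := by linarith
        _ = 8 * L * n / M := by ring
    have t2 : 2 / K₀r ≤ 16 * h * n * L := by
      calc 2 / K₀r = 2 * (1 / K₀r) := by ring
        _ ≤ 2 * (8 * h * n * L) := by linarith
        _ = 16 * h * n * L := by ring
    have t3 : 8 * n * ℓ' * h / Pr ≤ 8 * n * L * h := by
      calc 8 * n * ℓ' * h / Pr ≤ 8 * n * ℓ' * h := div_le_self (by positivity) hP1
        _ ≤ 8 * n * L * h := by
            have := mul_le_mul_of_nonneg_left hℓ'LR (by positivity : (0 : ℝ) ≤ 8 * n * h)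
            have e1 : 8 * (n : ℝ) * h * ℓ' = 8 * n * ℓ' * h := by ring
            have e2 : 8 * (n : ℝ) * h * L = 8 * n * L * h := by ring
            linarith
    have t4 : 8 * (L : ℝ) * n / M ≤ 8 * L * n * h := by
      rw [div_le_iff₀ hM0]
      have : 8 * (L : ℝ) * n * 1 ≤ 8 * L * n * (h * M) := mul_le_mul_of_nonneg_left hhM (by positivity)
      linarith
    have hsum : 2 / K₁r + 2 / K₀r + 8 * n * ℓ' * h / Pr ≤ 32 * L * n * h := by linarith
    have hcoef : B 0 * ρ / n ≤ N₀ * L / n :=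
      div_le_div_of_nonneg_right (mul_le_mul hB0N hρL hρ0 hN₀) hn0.le
    calc B 0 * ρ / n * (2 / K₁r + 2 / K₀r + 8 * n * ℓ' * h / Pr) ≤ (N₀ * L / n) * (32 * L * n * h) :=
          mul_le_mul hcoef hsum (by positivity) (by positivity)
      _ = 32 * N₀ * L ^ 2 * h := by field_simp
  -- (4) tail
  have h4 : ρ / n * (1 / Pr) * (5 * N₂ / (2 * (K₁r * n * ℓ' * h / gr))) ≤ 10 * N₂ * L ^ 2 / κ / n := by
    have t1 : 1 / Pr ≤ 1 := by rw [div_le_one hP0]; exact hP1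
    have t2 : 5 * N₂ / (2 * (K₁r * n * ℓ' * h / gr)) ≤ 5 * N₂ / 2 * (4 * L / κ) := by
      have e : 5 * N₂ / (2 * (K₁r * n * ℓ' * h / gr)) = 5 * N₂ / 2 * (1 / (K₁r * n * ℓ' * h / gr)) := by
        field_simp
      rw [e]; exact mul_le_mul_of_nonneg_left hVinv (by positivity)
    calc ρ / n * (1 / Pr) * (5 * N₂ / (2 * (K₁r * n * ℓ' * h / gr))) ≤ (L / n) * 1 * (5 * N₂ / 2 * (4 * L / κ)) :=
          mul_le_mul (mul_le_mul (div_le_div_of_nonneg_right hρL hn0.le) t1 (by positivity) (by positivity)) t2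
            (by positivity) (by positivity)
      _ = 10 * N₂ * L ^ 2 / κ / n := by field_simp; ring
  -- (5) `β` against `∫B`
  have h5 : h * (8 * N₀ * h) * ρ' * K₁r ≤ 8 * N₀ * L ^ 2 * h * κ / n := by
    calc h * (8 * N₀ * h) * ρ' * K₁r ≤ h * (8 * N₀ * h) * L * (L * M / n) :=
          mul_le_mul (mul_le_mul_of_nonneg_left hρ'L (by positivity)) hK₁LM hK₁0.le (by positivity)
      _ = 8 * N₀ * L ^ 2 * h * κ / n := by rw [hκ]; field_simp
  -- (6) the floor term
  have h6 : β * ρ' * h ≤ 8 * N₀ * L ^ 2 * h := by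
    have : β * ρ' ≤ 8 * N₀ * L := mul_le_mul hβ8 hρ'L hρ'0 (by positivity)
    have h' : 8 * N₀ * (L : ℝ) ≤ 8 * N₀ * L ^ 2 := by
      have := mul_le_mul_of_nonneg_left hLR (by positivity : (0 : ℝ) ≤ 8 * N₀ * L)
      have e : 8 * N₀ * (L : ℝ) * L = 8 * N₀ * L ^ 2 := by ring
      linarith
    exact mul_le_mul_of_nonneg_right (this.trans h') hh.le
  -- combine
  have hfinal : (192 * N₁ + 12 * N₀) * 16 * L ^ 3 * h * κ / n + (192 * N₁ + 12 * N₀) * h * L * (1 + Real.log M) / n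
      + (64 * N₀ * L ^ 2 * h * κ / n) + 4 * C₂ * L / κ / n + 10 * N₂ * L ^ 2 / κ / n + 8 * N₀ * L ^ 2 * h * κ / n
      ≤ (h * (h * M) * L ^ 3 * (3072 * N₁ + 264 * N₀) + h * (1 + Real.log M) * L * (192 * N₁ + 12 * N₀)
          + (4 * C₂ + 10 * N₂) * L ^ 2 / (h * M)) / n := by
    rw [← hκ, ← add_div, ← add_div, ← add_div, ← add_div, ← add_div]
    refine div_le_div_of_nonneg_right ?_ hn0.le
    have e1 : 4 * C₂ * L / κ + 10 * N₂ * L ^ 2 / κ ≤ (4 * C₂ + 10 * N₂) * L ^ 2 / κ := by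
      rw [← add_div]
      refine div_le_div_of_nonneg_right ?_ hκ0.le
      have : 4 * C₂ * (L : ℝ) * 1 ≤ 4 * C₂ * L * L := mul_le_mul_of_nonneg_left hLR (by positivity)
      have e : (4 * C₂ + 10 * N₂) * (L : ℝ) ^ 2 = 4 * C₂ * L * L + 10 * N₂ * L ^ 2 := by ring
      linarith
    have e2 : (192 * N₁ + 12 * N₀) * 16 * L ^ 3 * h * κ + 64 * N₀ * L ^ 2 * h * κ + 8 * N₀ * L ^ 2 * h * κ
        ≤ h * κ * L ^ 3 * (3072 * N₁ + 264 * N₀) := by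
      have hL23 : (L : ℝ) ^ 2 * 1 ≤ L ^ 2 * L := mul_le_mul_of_nonneg_left hLR (by positivity)
      have := mul_le_mul_of_nonneg_left hL23 (by positivity : 0 ≤ 72 * N₀ * h * κ)
      have e : h * κ * (L : ℝ) ^ 3 * (3072 * N₁ + 264 * N₀)
          = (192 * N₁ + 12 * N₀) * 16 * L ^ 3 * h * κ + 72 * N₀ * h * κ * (L ^ 2 * L) := by ring
      have e' : 64 * N₀ * (L : ℝ) ^ 2 * h * κ + 8 * N₀ * L ^ 2 * h * κ = 72 * N₀ * h * κ * (L ^ 2 * 1) := by ring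
      linarith
    have e3 : (192 * N₁ + 12 * N₀) * h * (L : ℝ) * (1 + Real.log M) = h * (1 + Real.log M) * L * (192 * N₁ + 12 * N₀) := by
      ring
    linarith [e1, e2, e3]
  -- the family block splits into its three parts
  have hAsplit : (192 * N₁ + 12 * N₀) * h * ρ * (16 * h * ℓ' * K₁r / gr + HK / n)
      = (192 * N₁ + 12 * N₀) * h * ρ * (16 * h * ℓ' * K₁r / gr) + (192 * N₁ + 12 * N₀) * h * ρ * (HK / n) := by ring
  linarith [hA1, hA2, hA3, hE1, hE2, h3, h4, h5, h6, hfinal, hAsplit]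

/-- **Anchor `combTypeNodeSharpMain`** (registered sub-goal; `node_sharp_main` with explicit quantifiers): the sharp node weight of a
main-range node with errors `e₀ + e₁/n`. [folklore] -/
theorem combTypeNodeSharpMain : ∀ B B' B'' : ℝ → ℝ, ∀ N₀ N₁ N₂ h : ℝ, ∀ L ℓ ℓ' M n : ℕ, (∀ x, HasDerivAt B (B' x) x) → (∀ x, HasDerivAt B' (B'' x) x) → (∀ x, |B x| ≤ N₀) → (∀ x, |B' x| ≤ N₁) → (∀ x, |B'' x| ≤ N₂) → (∀ x, 2 < |x| → B x = 0) → (∀ x, 0 ≤ B x) → (1 ≤ L) → (1 ≤ ℓ) → (ℓ ≤ L) → (1 ≤ ℓ') → (ℓ' ≤ L) → (1 ≤ n) → (0 < h) → (h ≤ 1 / (32 * L)) → (1 ≤ h * M) → (2 * (L : ℝ) ≤ h * M) → (8 * h * L ^ 2 * n ≤ 1) → |(∑ k' ∈ Finset.Icc 1 M, (∑ k ∈ Finset.Icc 1 M, B ((Real.log ((n : ℝ) * ℓ' * k' / ℓ) - Real.log k) / h) / Real.sqrt k) / Real.sqrt k' / Real.sqrt n) - B 0 * (Real.sqrt ℓ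 / Real.sqrt ℓ') * (∑ k' ∈ Finset.Icc 1 ⌊1 / (4 * h) / ((n : ℝ) * ℓ')⌋₊, (if ℓ ∣ n * ℓ' * k' then 1 / (k' : ℝ) else 0)) / n - h * (∫ v, B v * Real.exp (-(h * v) / 2)) * (Real.sqrt ℓ' / Real.sqrt ℓ) * ((min M ⌊(ℓ : ℝ) * M * Real.exp (-(2 * h)) / (ℓ' * n)⌋₊ - ⌊1 / (4 * h) / ((n : ℝ) * ℓ')⌋₊ : ℕ) : ℝ) - ((Real.sqrt ℓ / Real.sqrt ℓ') * ((Nat.gcd (n * ℓ') ℓ : ℝ) / ℓ) * (B 0 * Real.log (2 * (Nat.gcd (n * ℓ') ℓ : ℝ)) + (∫ v in Set.Ioi (1 / 2 : ℝ), ((∑' m : ℤ, B (m / v)) - v * ∫ x, B x) / v) - (∫ x, B x) / 2) + (∫ v, B v * Real.exp (-(h * v) / 2)) * (Real.sqrt ℓ' / Real.sqrt ℓ) / (4 * ℓ')) / n| ≤ h * L ^ 2 * ((32 * N₁ + 28 * N₀) * (1 + 7 * Real.sqrt (h * M * L)) + 48 * N₀) + (h * (h * M) * L ^ 3 * (3072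 * N₁ + 264 * N₀) + h * (1 + Real.log M) * L * (192 * N₁ + 12 * N₀) + (4 * ((N₀ + 2 * N₁ + N₂) * (96 + 192 * L) * L ^ 2) + 10 * N₂) * L ^ 2 / (h * M)) / n :=
  fun _ _ _ _ _ _ _ _ _ _ _ _ hB hB' h0 h1 h2 hBs hB0 hL hℓ hℓL hℓ' hℓ'L hn hh hhL hhM hκL hnY =>
    node_sharp_main hB hB' h0 h1 h2 hBs hB0 hL hℓ hℓL hℓ' hℓ'L hn hh hhL hhM hκL hnY

end CombType

end Summit.RiemannHypothesis.RiemannHypothesis.Theorems.SignConeConeMagnification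

end
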